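import Summits.AnomalousDissipation.AnomalousDissipation.Theorems.SolenoidalFractalHomogenisationLagrangianStepCellLawVExactDesign
import HarnessLib

/-!
# K1L_D (stmt-AnomalousDissipation-27980), stub `stub_cellLawV0_IS` — W5 odd half: THE BRANCH-B DESIGN POINT, instantiated

(planner ad-ideate-p5 g8, lens «profile».)  The design of record `ΛV = 1.10`, `τ₀ = 0.2`, `T₀ = 30` plugged into the worker's
`oddSectorial_excQS_contraction_exact` / `oddSectorial_excQS_exact` (p659721): for every `M` with all slot relaxations `4π²|m_s|²Mτ_s ≥ 30`,
every `τ ∈ [0, 1/5]` and every background `S` with `NearIso S (10/11) (11/10)` and `OddSectorial S τ`: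
`OddSectorial (excQS W₀ M S) ((93/100)·τ)` — the odd Kato sector CONTRACTS by `0.93` under the quasi-static one-step excess; and (even half,
`M ≥ 0`, all `q p`) `0.97·gainForm W₀ M (11/10) q p/(11/10) ≤ symb (excQS W₀ M S) q p ≤ gainForm W₀ M (10/11) q p/(10/11)`.
Pure arithmetic on top of p659721 / p657520 / p656003 (`√5 ≤ 2.2361`, `m₂(1/5) ≥ 0.294`, `δ(1/5) ≤ 0.03`).  NOT a proof of the stub / crux / AD.  No named facts, no sorry.
-/

set_option linter.dupNamespace false

namespace Summit.AnomalousDissipation.AnomalousDissipation.Theorems.SolenoidalFractalHomogenisation.LagrangianStep.OddGain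

open Literature.Analysis Literature.Analysis.FunctionSpaces Literature.Analysis.FluidPDE
open Literature.Analysis.FluidPDE.LatticeShear

/-- `√5 ≤ 2.2361`. [folklore] -/
theorem sqrt_five_le : Real.sqrt 5 ≤ 2.2361 := by
  rw [show (2.2361 : ℝ) = Real.sqrt (2.2361 ^ 2) by rw [Real.sqrt_sq]; norm_num]
  exact Real.sqrt_le_sqrt (by norm_num)

/-- **THE BRANCH-B DESIGN POINT** (`ΛV = 1.10`, `τ₀ = 1/5`, `T₀ = 30`; `κ = 0.93`): for the isotropic cubature word `W₀` and every Lagrangian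
parameter `M` whose slot relaxations satisfy `4π²|m_s|²·M·τ_s ≥ 30` (`s = 1…26`), every `τ ∈ [0, 1/5]` and every background `S` with
`NearIso S (10/11) (11/10)` and `OddSectorial S τ`, the quasi-static excess is in the CONTRACTED sector: `OddSectorial (excQS W₀ M S) (0.93·τ)`. [folklore] -/
theorem oddSectorial_excQS_design_point (Mlag : ℝ)
    (hTs : ∀ s : Fin 26, 30 ≤ 4 * Real.pi ^ 2 * ‖Torus.latticeVec (cubatureWord.phase s).m‖ ^ 2 * Mlag * (cubatureWord.phase s).τ)
    {τ : ℝ} (hτ : τ ∈ Set.Icc 0 (1 / 5)) {S : Torus.Visc4 (Fin 3)} (hS : Torus.NearIso S (10 / 11) (11 / 10))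
    (hodd : OddSectorial S τ) :
    OddSectorial (excQS cubatureWord Mlag S) (93 / 100 * τ) := by
  have hρ : cubatureWord.ramp = 1 / 2 := rfl
  obtain ⟨hτ0, hτ1⟩ := hτ
  have h5 := sqrt_five_le
  have h5pos : 0 < Real.sqrt 5 := Real.sqrt_pos.2 (by norm_num)
  have h55 : Real.sqrt 5 * Real.sqrt 5 = 5 := Real.mul_self_sqrt (by norm_num)
  set c : ℝ := 93 / 100 * 3 / Real.sqrt 5 with hc
  have hc0 : 0 ≤ c := by positivity
  have h2 : (1 - 4 * cubatureWord.ramp / 3) / (10 / 11 : ℝ) ≤ c * (294 / 1000) := by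
    rw [hρ, hc]
    rw [show (93 / 100 * 3 / Real.sqrt 5 * (294 / 1000) : ℝ) = (93 / 100 * 3 * (294 / 1000)) / Real.sqrt 5 by ring]
    rw [le_div_iff₀ h5pos]
    nlinarith [h5]
  have h1 : (294 / 1000 : ℝ) ≤ (1 - 4 * cubatureWord.ramp / 3 - 2 / (cubatureWord.ramp * (30 * (11 / 10 : ℝ)) ^ 2)) / (11 / 10) -
      (τ * (11 / 10)) ^ 2 * (1 - 4 * cubatureWord.ramp / 3) / (4 * (10 / 11 : ℝ) ^ 3) := by
    rw [hρ]
    have hmon : (τ * (11 / 10)) ^ 2 * (1 - 4 * (1 / 2 : ℝ) / 3) / (4 * (10 / 11 : ℝ) ^ 3) ≤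
        ((1 / 5 : ℝ) * (11 / 10)) ^ 2 * (1 - 4 * (1 / 2 : ℝ) / 3) / (4 * (10 / 11 : ℝ) ^ 3) := by
      apply div_le_div_of_nonneg_right _ (by norm_num)
      apply mul_le_mul_of_nonneg_right _ (by norm_num)
      exact pow_le_pow_left₀ (by positivity) (by nlinarith) 2
    have hval : (294 / 1000 : ℝ) ≤ (1 - 4 * (1 / 2 : ℝ) / 3 - 2 / ((1 / 2 : ℝ) * (30 * (11 / 10 : ℝ)) ^ 2)) / (11 / 10) -
        ((1 / 5 : ℝ) * (11 / 10)) ^ 2 * (1 - 4 * (1 / 2 : ℝ) / 3) / (4 * (10 / 11 : ℝ) ^ 3) := by norm_num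
    linarith
  have h := oddSectorial_excQS_exact Mlag (lo := 10 / 11) (hi := 11 / 10) (by norm_num) (by norm_num) (by norm_num)
    (by norm_num : (0:ℝ) ≤ 294 / 1000) hc0 hτ0 (by norm_num : (0:ℝ) < 30) hTs h1 h2 hS hodd
  have e : c * Real.sqrt 5 / 3 * τ = 93 / 100 * τ := by
    rw [hc]; field_simp
  rwa [e] at h

/-- **THE BRANCH-B DESIGN POINT, EVEN HALF** (same numbers): for `W₀`, `M ≥ 0` with slot relaxations `≥ 30`, `τ ∈ [0, 1/5]`,
`NearIso S (10/11) (11/10)`, `OddSectorial S τ` and all `q p`: the even symbol of the quasi-static excess is pinched between the gain forms,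
`0.97·gainForm W₀ M (11/10) q p/(11/10) ≤ symb (excQS W₀ M S) q p ≤ gainForm W₀ M (10/11) q p/(10/11)` (w1's `le_symb_excQS_of_design₂`
p657520 at `δ = 3/100` and `symb_excQS_le_of_nearIso` p656003). [folklore] -/
theorem evenPinch_excQS_design_point (Mlag : ℝ) (hM : 0 ≤ Mlag)
    (hTs : ∀ s : Fin 26, 30 ≤ 4 * Real.pi ^ 2 * ‖Torus.latticeVec (cubatureWord.phase s).m‖ ^ 2 * Mlag * (cubatureWord.phase s).τ)
    {τ : ℝ} (hτ : τ ∈ Set.Icc 0 (1 / 5)) {S : Torus.Visc4 (Fin 3)} (hS : Torus.NearIso S (10 / 11) (11 / 10))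
    (hodd : OddSectorial S τ) (q p : Fin 3 → ℝ) :
    97 / 100 * (gainForm cubatureWord Mlag (11 / 10) q p / (11 / 10)) ≤ Torus.symb (excQS cubatureWord Mlag S) q p ∧
      Torus.symb (excQS cubatureWord Mlag S) q p ≤ gainForm cubatureWord Mlag (10 / 11) q p / (10 / 11) := by
  have hρ : cubatureWord.ramp = 1 / 2 := rfl
  obtain ⟨hτ0, hτ1⟩ := hτ
  have hδ : (τ * (11 / 10 : ℝ)) ^ 2 * (1 - 4 * cubatureWord.ramp / 3) / (4 * (10 / 11 : ℝ) ^ 3) +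
      2 / (cubatureWord.ramp * (30 * (11 / 10 : ℝ)) ^ 2) / (11 / 10) ≤ 3 / 100 * ((1 - 4 * cubatureWord.ramp / 3) / (11 / 10 : ℝ)) := by
    rw [hρ]
    have hmon : (τ * (11 / 10)) ^ 2 * (1 - 4 * (1 / 2 : ℝ) / 3) / (4 * (10 / 11 : ℝ) ^ 3) ≤
        ((1 / 5 : ℝ) * (11 / 10)) ^ 2 * (1 - 4 * (1 / 2 : ℝ) / 3) / (4 * (10 / 11 : ℝ) ^ 3) := by
      apply div_le_div_of_nonneg_right _ (by norm_num)
      apply mul_le_mul_of_nonneg_right _ (by norm_num)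
      exact pow_le_pow_left₀ (by positivity) (by nlinarith) 2
    have hval : ((1 / 5 : ℝ) * (11 / 10)) ^ 2 * (1 - 4 * (1 / 2 : ℝ) / 3) / (4 * (10 / 11 : ℝ) ^ 3) +
        2 / ((1 / 2 : ℝ) * (30 * (11 / 10 : ℝ)) ^ 2) / (11 / 10) ≤ 3 / 100 * ((1 - 4 * (1 / 2 : ℝ) / 3) / (11 / 10 : ℝ)) := by norm_num
    linarith
  refine ⟨?_, symb_excQS_le_of_nearIso cubatureWord hM (by norm_num) (by norm_num) (by norm_num) hS q p⟩
  have h := le_symb_excQS_of_design₂ cubatureWord (lo := 10 / 11) (hi := 11 / 10) (δ := 3 / 100) (T₀ := 30)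
    (by norm_num) (by norm_num) (by norm_num) hτ0 (by norm_num) (by norm_num) hTs hδ hS hodd q p
  have e : (1 - 3 / 100 : ℝ) = 97 / 100 := by norm_num
  rwa [e] at h

/-! ## The slot relaxations of the cubature word and the design point in terms of `M` alone -/

section SlotRelax

open Literature.Algebra.EuclideanLattices (norm_sq_fin_three)

/-- Every slot relaxation of the isotropic cubature word is at least `160π²·M` per unit `M`: `4π²|m_s|²τ_s ≥ 160π²`
(axes `|m|² = 1, τ = 40`; face diagonals `2·128`; body diagonals `3·243`). [folklore] -/
theorem slotRelax_ge (s : Fin 26) :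
    160 * Real.pi ^ 2 ≤ 4 * Real.pi ^ 2 * ‖Torus.latticeVec (cubatureWord.phase s).m‖ ^ 2 * (cubatureWord.phase s).τ := by
  have hM2 : ‖Torus.latticeVec (cubatureWord.phase s).m‖ ^ 2 =
      ((slots s).m 0 : ℝ) ^ 2 + ((slots s).m 1 : ℝ) ^ 2 + ((slots s).m 2 : ℝ) ^ 2 := by
    rw [norm_sq_fin_three]; simp only [Torus.latticeVec_apply]; rfl
  have hτ : (cubatureWord.phase s).τ = ((slots s).τ : ℝ) := rfl
  have h40 : (40 : ℝ) ≤ (((slots s).m 0 : ℝ) ^ 2 + ((slots s).m 1 : ℝ) ^ 2 + ((slots s).m 2 : ℝ) ^ 2) * ((slots s).τ : ℝ) := by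
    fin_cases s <;> simp [slots] <;> norm_num
  rw [hM2, hτ]
  have hπ : 0 < Real.pi ^ 2 := by positivity
  nlinarith [h40, hπ]

/-- `M ≥ 1/50` puts every slot relaxation above `T₀ = 30` (`160π²/50 = 31.6`). [folklore] -/
theorem slotRelax_ge_thirty {Mlag : ℝ} (hM : 1 / 50 ≤ Mlag) (s : Fin 26) :
    30 ≤ 4 * Real.pi ^ 2 * ‖Torus.latticeVec (cubatureWord.phase s).m‖ ^ 2 * Mlag * (cubatureWord.phase s).τ := by
  have h := slotRelax_ge s
  have hπ := Real.pi_gt_d2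
  have hτ0 : 0 < (cubatureWord.phase s).τ := (cubatureWord.phase s).τ_pos
  have hA : 0 ≤ 4 * Real.pi ^ 2 * ‖Torus.latticeVec (cubatureWord.phase s).m‖ ^ 2 := by positivity
  have e : 4 * Real.pi ^ 2 * ‖Torus.latticeVec (cubatureWord.phase s).m‖ ^ 2 * Mlag * (cubatureWord.phase s).τ =
      Mlag * (4 * Real.pi ^ 2 * ‖Torus.latticeVec (cubatureWord.phase s).m‖ ^ 2 * (cubatureWord.phase s).τ) := by ring
  rw [e]
  have hπ2 : (3.14 : ℝ) ^ 2 < Real.pi ^ 2 := by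
    have : (0:ℝ) ≤ 3.14 := by norm_num
    nlinarith
  calc (30 : ℝ) ≤ 1 / 50 * (160 * Real.pi ^ 2) := by nlinarith
    _ ≤ Mlag * (160 * Real.pi ^ 2) := mul_le_mul_of_nonneg_right hM (by positivity)
    _ ≤ Mlag * (4 * Real.pi ^ 2 * ‖Torus.latticeVec (cubatureWord.phase s).m‖ ^ 2 * (cubatureWord.phase s).τ) :=
        mul_le_mul_of_nonneg_left h (by linarith)

/-- **DESIGN POINT IN TERMS OF `M` ALONE (odd half)**: `M ≥ 1/50`, `τ ∈ [0, 1/5]`, `NearIso S (10/11) (11/10)`, `OddSectorial S τ` ⇒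
`OddSectorial (excQS W₀ M S) (0.93·τ)`. [folklore] -/
theorem oddSectorial_excQS_design_point' {Mlag : ℝ} (hM : 1 / 50 ≤ Mlag)
    {τ : ℝ} (hτ : τ ∈ Set.Icc 0 (1 / 5)) {S : Torus.Visc4 (Fin 3)} (hS : Torus.NearIso S (10 / 11) (11 / 10))
    (hodd : OddSectorial S τ) :
    OddSectorial (excQS cubatureWord Mlag S) (93 / 100 * τ) :=
  oddSectorial_excQS_design_point Mlag (slotRelax_ge_thirty hM) hτ hS hodd

/-- **DESIGN POINT IN TERMS OF `M` ALONE (even half)**: `M ≥ 1/50`, `τ ∈ [0, 1/5]`, `NearIso S (10/11) (11/10)`, `OddSectorial S τ` ⇒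
`0.97·gainForm W₀ M (11/10) q p/(11/10) ≤ symb (excQS W₀ M S) q p ≤ gainForm W₀ M (10/11) q p/(10/11)`. [folklore] -/
theorem evenPinch_excQS_design_point' {Mlag : ℝ} (hM : 1 / 50 ≤ Mlag)
    {τ : ℝ} (hτ : τ ∈ Set.Icc 0 (1 / 5)) {S : Torus.Visc4 (Fin 3)} (hS : Torus.NearIso S (10 / 11) (11 / 10))
    (hodd : OddSectorial S τ) (q p : Fin 3 → ℝ) :
    97 / 100 * (gainForm cubatureWord Mlag (11 / 10) q p / (11 / 10)) ≤ Torus.symb (excQS cubatureWord Mlag S) q p ∧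
      Torus.symb (excQS cubatureWord Mlag S) q p ≤ gainForm cubatureWord Mlag (10 / 11) q p / (10 / 11) :=
  evenPinch_excQS_design_point Mlag (by linarith) (slotRelax_ge_thirty hM) hτ hS hodd q p

end SlotRelax

end Summit.AnomalousDissipation.AnomalousDissipation.Theorems.SolenoidalFractalHomogenisation.LagrangianStep.OddGain
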